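import Mathlib
import Summits.Ventures.HodgeRepro2.DoubleCosetMem

/-!
# HeckeSpectralReal — the spectral theorem for one Hecke operator on `S_k(Γ')`: an orthonormal
basis of `T_δ`-eigenforms with REAL eigenvalues, under `δ⁻¹ ∈ S δ S`

Blind cell `pub-hodge-repro2`, seat p2 (Tier 5 kernel support, Hecke side).

`HeckeEigenformsUnconditional.lean` gives an orthonormal eigenbasis of the holomorphic part of the
Petersson space for a single operator `T_δ` with `T_δ = T_{δ⁻¹}`; `DoubleCosetMem.lean` gives
`T_δ = T_{δ⁻¹}` from `δ⁻¹ ∈ SδS` and the reality of the eigenvalues. Together: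

* **`exists_orthonormalBasis_heckeSpace_holomorphic_real_of_inv_mem_doubleCoset`**: for a
  congruence subgroup `S ⊆ Γ_N` of finite index in `Γ_1` with compact quotient and a measurable
  fundamental domain, and any rational unitary `δ` with `δ⁻¹ ∈ SδS`, the holomorphic weight-`k`
  Petersson space has an orthonormal basis `b` with `T_δ (b a) = r_a • b a`, `r_a ∈ ℝ` —
  «`T_δ` is self-adjoint, hence diagonalisable with real eigenvalues in an orthonormal basis of
  `S_k(Γ)`».
-/

namespace Summit.Ventures.HodgeRepro2.ShimuraData

open MeasureTheory

variable {K : Type*} [Field K] [NumberField K] [NumberField.IsCMField K] {τ₁ : K →+* ℂ}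
  {H : Matrix (Fin 3) (Fin 3) K} {Q : Matrix (Fin 3) (Fin 3) ℂ} {𝔪 : Submodule ℤ (Fin 3 → K)}

/-- **Real spectral theorem for `T_δ` on the holomorphic weight-`k` forms**, under `δ⁻¹ ∈ SδS`. -/
theorem exists_orthonormalBasis_heckeSpace_holomorphic_real_of_inv_mem_doubleCoset
    (hH : IsHermitianForm K H)
    (hdef : ∀ τ : K →+* ℂ, NumberField.InfinitePlace.mk τ ≠ NumberField.InfinitePlace.mk τ₁ →
      IsDefiniteAt K τ H)
    (hQ : IsFrame K τ₁ H Q) (h𝔪 : IsLattice K 𝔪) {N : ℕ} {S : Subgroup (GL (Fin 3) K)}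
    (hS : (S : Set (GL (Fin 3) K)) ⊆ shimuraLevel K H 𝔪 N)
    (hS₁ : S ≤ shimuraLevelSubgroup K H 𝔪 1)
    (hfin : (S.subgroupOf (shimuraLevelSubgroup K H 𝔪 1)).FiniteIndex)
    [CompactSpace (ballQuotient hQ S (subset_unitaryGroup_of_subset_shimuraLevel hS))]
    {D : Set ball₂} (k : ℕ)
    (hD : IsBallFundamentalDomain hQ S (subset_unitaryGroup_of_subset_shimuraLevel hS) D)
    (hDm : MeasurableSet D) (δ : unitaryGroup K H)
    (hmem : (δ : GL (Fin 3) K)⁻¹ ∈ doubleCoset S (δ : GL (Fin 3) K)) :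
    ∃ b : OrthonormalBasis (Fin (Module.finrank ℂ (holomorphicSpace hQ S _ k hD))) ℂ
        (holomorphicSpace hQ S _ k hD), ∀ a, ∃ r : ℝ,
      heckeFamilyOf hQ S _ k hD hDm (fun δ => fintypeHeckeQuotientOfFiniteIndex h𝔪 hS₁ hfin δ.2)
        δ (b a) = (r : ℂ) • (b a : PeterssonSpace hQ S _ k hD) := by
  set inst : ∀ δ : unitaryGroup K H,
      Fintype (S ⧸ (heckeSubgroup S (δ : GL (Fin 3) K)).subgroupOf S) :=
    fun δ => fintypeHeckeQuotientOfFiniteIndex h𝔪 hS₁ hfin δ.2 with hinst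
  have hself : heckeFamilyOf hQ S _ k hD hDm inst δ = heckeFamilyOf hQ S _ k hD hDm inst δ⁻¹ :=
    heckeFamilyOf_eq_inv_of_inv_mem_doubleCoset hQ S
      (subset_unitaryGroup_of_subset_shimuraLevel hS) k hD hDm inst hmem
  obtain ⟨b, hb⟩ := exists_orthonormalBasis_heckeSpace_holomorphic_of_self_adjoint hH hdef hQ h𝔪
    hS hS₁ hfin k hD hDm δ hself
  refine ⟨b, fun a => ?_⟩
  obtain ⟨μ, hμ⟩ := hb a
  have hne : (b a : PeterssonSpace hQ S _ k hD) ≠ 0 := by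
    intro h
    have h1 : b a = 0 := Subtype.ext h
    have h2 := b.orthonormal.ne_zero a
    exact h2 h1
  obtain ⟨r, hr⟩ := heckeFamilyOf_eigenvalue_real_of_eq_inv hQ S
    (subset_unitaryGroup_of_subset_shimuraLevel hS) k hD hDm inst hself hne hμ
  exact ⟨r, by rw [← hr]; exact hμ⟩

end Summit.Ventures.HodgeRepro2.ShimuraData
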